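import Summits.HodgeConjecture.Ring2.RowFourTypeIVOneOne
import Literature.AlgebraicGeometry.HodgeTheory.AbelianFivefoldHodgeRingHardLefschetz
import HarnessLib

/-!
# Ring 2 (cell topic `Summits/HodgeConjecture/Ring2/`; seat `lit`, gen 70, R47-A′): MOONEN–ZARHIN Thm. 0.2 IN ALL CODIMENSIONS — every complex abelian FIVEFOLD has `B³ ⊆ D³ + D¹ · Σ_α α^* B²(X')` UNCONDITIONALLY, `Bᵖ = Dᵖ` for `p ∉ {2,3}`, and the `W_{k,α}` form modulo the row-four residual alone

HONEST FRAMING (cell `pub-hodge-ring2`, verbatim): research route conditional on HC_CM; not a corollary;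
Q11.4-sentence-2 already refuted in dim ≥ 3. `HC_CM` does NOT occur in this file; Markman's theorem does not occur; the
fourfold fact `MoonenZarhin1999_codimTwoHodgeClasses_abelianFourfold` occurs only as a HYPOTHESIS of §2's conditional
forms. Theorems only — no definition, no named fact, no `sorry`.

THE PRINT. B. Moonen, Yu. Zarhin, *Hodge classes on abelian varieties of low dimension*, Math. Ann. **315** (1999)
711–733, Thm. 0.2: «(1) [case (e)] … the Hodge ring `B•(X)` is generated by the subalgebra `D•(X)` of divisor classes
together with the subspaces `W_{k,α}` … (2) [case (f)] … `B•(X)` is generated by the divisor classes `D•(X)` together with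
the pull-backs of the Weil classes in `W_k ⊂ B²(X₁ × X₂)` … (3) [case (g)] `B•(X) = D•(X)` … (4) … `B•(Xⁿ)` is generated by
the images of the Hodge rings `B•(Y_j^{m_j})`»; remark after Thm. 0.2: «in the cases (e) and (f) … `D²(X) ≠ B²(X)` and
`D³(X) ≠ B³(X)`»; §5 (5.12): «By the duality `Hʲ(X,ℚ)(5) ≅ H^{10-j}(X,ℚ)^∨` we only have to show that `B²(X)` … is
generated by `D²(X)` and the spaces `W_{k,α}`».

THIS FILE assembles (i) the cell's UNCONDITIONAL codimension-`2` theorem for every fivefold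
(`FivefoldFactHolds.isCodimTwoDivisorPullbackGenerated_of_dim_eq_five`: `B² ⊆ D² + Σ_α α^* B²(X')`, lit g68 R44) with
(ii) the Literature lane's hard-Lefschetz passage `HodgeTheory/AbelianFivefoldHodgeRingHardLefschetz` (lit g70 R47-A:
`IsCodimTwoDivisorPullbackGenerated.codimThree`, `.codimTwo_weil`, `.codimThree_weil`; print uses duality, the tree
hard Lefschetz — Voisin I Thm. 6.25) and (iii) the row-four census (`NonSimpleFourfoldsCodimTwo`: `B² ⊆ D² + Σ W_K` for
every NON-SIMPLE and every CM fourfold; `RowFourTypeIVOneOne`: for every simple fourfold with imaginary-quadratic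
`End⁰`, and the fourfold fact ↔ its residual instances).
* §1 **`codimThree_of_dim_eq_five`** — FOR EVERY complex abelian fivefold, every rational `(3,3)`-class lies in
  `D³ ⊗ ℂ ⊔ span {κ ∪ α^* w}` (`κ` rational `(1,1)`, `α : X ⟶ B` surjective onto a fourfold, `w` rational `(2,2)` on
  `B`) — UNCONDITIONAL; **`moonenZarhin1999_thm02_allCodim_of_dim_eq_five`** — the three rows together: `Bᵖ ⊆ Dᵖ ⊗ ℂ`
  for `p ∉ {2,3}`, the codimension-`2` predicate, the codimension-`3` row.
* §2 THE `W_{k,α}` FORM («`D• + D• · Σ W_{k,α}`», Weil classes of the fourfold quotients instead of all their rational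
  `(2,2)`-classes): **`codimTwo_weil_of_quotients`**, **`codimThree_weil_of_quotients`** — UNCONDITIONAL for the
  fivefolds all of whose surjective fourfold quotients are non-simple, of CM type, or simple with imaginary-quadratic
  endomorphism algebra (e.g. case (e) `X₁² × X₂` and case (f), whose fourfold quotients are non-simple);
  `…_of_fourfoldFact` — for every fivefold granted the fourfold fact; **`…_of_residual`** — for every fivefold granted
  ONLY `B² ⊆ D² + Σ W_K` on the row-four residual (simple non-CM fourfolds with `End⁰` not imaginary quadratic, not of
  minimal quaternion / maximal RM / quartic CM `{(1,1),(2,0)}` type).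

WHAT IS NOT CLAIMED: `D³ ≠ B³` in cases (e)/(f); Moonen–Zarhin's restriction to TWO pull-backs `W_{k,α₁}`, `W_{k,α₂}`;
the residual is not closed; no Hodge-conjecture statement (all degrees above the middle are already routed through hard
Lefschetz in `LowDimensionHodgeOfMarkman*`).

## References
* [MoonenZarhin1999LowDim] B. Moonen, Yu. Zarhin, Math. Ann. 315 (1999) 711–733, Thm. 0.1, Thm. 0.2 (1)–(4), remark
  after Thm. 0.2, §5 (5.11)–(5.12).
* [MoonenZarhin1995Duke] B. Moonen, Yu. Zarhin, Duke Math. J. 77 (1995), Thm. 2.4.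
* [VoisinHodgeI2002] C. Voisin, *Hodge Theory and Complex Algebraic Geometry I*, Thm. 6.25, Rem. 6.27.
* [vanGeemen1994HodgeAV] B. van Geemen, LNM 1594 (1994), §2.4–2.5.
-/

noncomputable section

open CategoryTheory CategoryTheory.Limits NumberField

namespace Summit.HodgeConjecture.Ring2.FivefoldHodgeRingAllCodimensions

open Literature.AlgebraicTopology.SingularHomology
open Literature.AlgebraicGeometry.Motives (AbelianVariety)
open Literature.AlgebraicGeometry.Motives.AbelianVariety
open Literature.AlgebraicGeometry.HodgeTheory
open Literature.AlgebraicGeometry.ComplexMultiplication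
open Literature.AlgebraicGeometry.Milne1999
open Literature.Barriers.HodgeConjecture (divisorClassesSpan)
open Literature.NumberTheory.Automorphic (IsQuaternionAlgebra)
open Summit.HodgeConjecture.Ring2.FivefoldFactHolds
open Summit.HodgeConjecture.Ring2.NonSimpleFourfoldsCodimTwo
open Summit.HodgeConjecture.Ring2.RowFourTypeIVOneOne

variable {X : AbelianVariety ℂ}

/-! ### §1 Codimension `3` on every fivefold, unconditionally; Thm. 0.2 in all degrees -/

/-- **MOONEN–ZARHIN Thm. 0.2, CODIMENSION `3`, FOR EVERY COMPLEX ABELIAN FIVEFOLD — UNCONDITIONAL**: every rational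
`(3,3)`-class `c ∈ H⁶(X, ℂ)` lies in `D³(X) ⊗ ℂ ⊔ span_ℂ {κ ∪ α^* w}` over the rational `(1,1)`-classes `κ` (the
hyperplane class suffices), the surjective homomorphisms `α : X ⟶ B` onto abelian FOURFOLDS and the rational
`(2,2)`-classes `w` on `B`: «`B³(X) = D³(X) + D¹(X) · Σ_α α^* B²(X')`». The cell's codimension-`2` theorem
`isCodimTwoDivisorPullbackGenerated_of_dim_eq_five` pushed to degree `6` by hard Lefschetz
(`IsCodimTwoDivisorPullbackGenerated.codimThree`). [cite: MoonenZarhin1999LowDim, Thm. 0.2 (1)–(4) and §5 (5.12)]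
[cite: VoisinHodgeI2002, Thm. 6.25 and Rem. 6.27] -/
theorem codimThree_of_dim_eq_five (hX5 : X.dim = 5) (c : complexBetti X.X (2 * 3)) (hc : IsRationalClass c)
    (h33 : IsOfHodgeType X.dim X.X (2 * 3) 3 3 c) :
    c ∈ divisorClassesSpan X.X X.dim 3 ⊔
      Submodule.span ℂ {x : complexBetti X.X (2 * 3) |
        ∃ (κ : complexBetti X.X 2) (B : AbelianVariety ℂ) (α : X ⟶ B) (w : complexBetti B.X (2 * 2)),
          IsRationalClass κ ∧ IsOfHodgeType X.dim X.X 2 1 1 κ ∧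
          B.dim = 4 ∧ AlgebraicGeometry.Surjective (AbelianVariety.Hom.toSchemeHom α) ∧
          IsRationalClass w ∧ IsOfHodgeType B.dim B.X (2 * 2) 2 2 w ∧
          x = cupProduct (show 2 + 2 * 2 = 2 * 3 by norm_num) κ (complexBetti.map α.hom.hom.hom (2 * 2) w)} :=
  (isCodimTwoDivisorPullbackGenerated_of_dim_eq_five hX5).codimThree hX5 c hc h33

/-- **MOONEN–ZARHIN Thm. 0.2 IN ALL CODIMENSIONS, FOR EVERY COMPLEX ABELIAN FIVEFOLD — UNCONDITIONAL** (the three rows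
together): (i) for `p ∉ {2, 3}` every rational `(p,p)`-class lies in `Dᵖ ⊗ ℂ`; (ii) `B² ⊆ D² ⊗ ℂ + Σ_α α^* B²(X')`
(`IsCodimTwoDivisorPullbackGenerated X`); (iii) `B³ ⊆ D³ ⊗ ℂ + D¹ · Σ_α α^* B²(X')`. So «the Hodge ring `B•(X)` is
generated by divisor classes together with the pull-backs [of the codimension-`2` Hodge classes of the fourfold
quotients]» in every degree. [cite: MoonenZarhin1999LowDim, Thm. 0.2 (1)–(4), §5 (5.11)–(5.12)]
[cite: VoisinHodgeI2002, Thm. 6.25 and Rem. 6.27] -/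
theorem moonenZarhin1999_thm02_allCodim_of_dim_eq_five (hX5 : X.dim = 5) :
    (∀ p : ℕ, p ≠ 2 → p ≠ 3 → ∀ c : complexBetti X.X (2 * p), IsRationalClass c →
      IsOfHodgeType X.dim X.X (2 * p) p p c → c ∈ divisorClassesSpan X.X X.dim p) ∧
    IsCodimTwoDivisorPullbackGenerated X ∧
    (∀ c : complexBetti X.X (2 * 3), IsRationalClass c → IsOfHodgeType X.dim X.X (2 * 3) 3 3 c →
      c ∈ divisorClassesSpan X.X X.dim 3 ⊔
        Submodule.span ℂ {x : complexBetti X.X (2 * 3) |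
          ∃ (κ : complexBetti X.X 2) (B : AbelianVariety ℂ) (α : X ⟶ B) (w : complexBetti B.X (2 * 2)),
            IsRationalClass κ ∧ IsOfHodgeType X.dim X.X 2 1 1 κ ∧
            B.dim = 4 ∧ AlgebraicGeometry.Surjective (AbelianVariety.Hom.toSchemeHom α) ∧
            IsRationalClass w ∧ IsOfHodgeType B.dim B.X (2 * 2) 2 2 w ∧
            x = cupProduct (show 2 + 2 * 2 = 2 * 3 by norm_num) κ (complexBetti.map α.hom.hom.hom (2 * 2) w)}) :=
  ⟨fun _ hp2 hp3 c hc hpp => hodgeClasses_divisorial_of_dim_eq_five_of_ne hX5 hp2 hp3 c hc hpp,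
    isCodimTwoDivisorPullbackGenerated_of_dim_eq_five hX5, codimThree_of_dim_eq_five hX5⟩

/-! ### §2 The `W_{k,α}` form: from the quotients, from the fourfold fact, from the residual alone -/

/-- **A fourfold that is non-simple, or of CM type, or simple with imaginary-quadratic endomorphism algebra satisfies
`B² ⊆ D² + Σ_K W_K` — UNCONDITIONALLY** (the cell's `isCodimTwoDivisorWeilGenerated_of_not_isSimple`,
`…_of_isOfCMType`, and the Literature lane's `AbelianVariety.isCodimTwoDivisorWeilGenerated_of_isSimple_of_finrank_end_eq_two`).
[cite: MoonenZarhin1999LowDim, Thm. 0.1 and §5 (5.1)] [cite: MoonenZarhin1995Duke, Thm. 2.4 and the type IV(1,1) row] -/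
theorem isCodimTwoDivisorWeilGenerated_of_not_isSimple_or_cm_or_imaginaryQuadratic {B : AbelianVariety ℂ}
    (hB4 : B.dim = 4)
    (h : ¬ B.IsSimple ∨ IsOfCMType B ∨
      ∃ (φ : B ⟶ B) (d : ℕ), 0 < d ∧ φ ≫ φ = -(d • 𝟙 B) ∧ Module.finrank ℚ B.endAlgebra = 2) :
    IsCodimTwoDivisorWeilGenerated B := by
  rcases h with hs | hcm | ⟨φ, d, hd, hφ, hE2⟩
  · exact isCodimTwoDivisorWeilGenerated_of_not_isSimple hB4 hs
  · exact isCodimTwoDivisorWeilGenerated_of_isOfCMType hB4 hcm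
  · by_cases hs : B.IsSimple
    · exact AbelianVariety.isCodimTwoDivisorWeilGenerated_of_isSimple_of_finrank_end_eq_two B hs φ hd hφ hE2 hB4
    · exact isCodimTwoDivisorWeilGenerated_of_not_isSimple hB4 hs

/-- **Thm. 0.2 (1)–(2), codimension `2`, `W_{k,α}` FORM — UNCONDITIONAL for a fivefold all of whose surjective fourfold
quotients are non-simple, of CM type, or simple with imaginary-quadratic `End⁰`** (cases (e) `X₁² × X₂`, (f)
`X₀ × X₁ × X₂`: the fourfold quotients are non-simple): `B²(X) ⊆ D²(X) ⊗ ℂ ⊔ span_ℂ {α^* w : w a rational (2,2) Weil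
class of a fourfold quotient}` = «`D²(X) + Σ W_{k,α}`». [cite: MoonenZarhin1999LowDim, Thm. 0.2 (1)–(2) and Thm. 0.1]
[cite: MoonenZarhin1995Duke, Thm. 2.4] -/
theorem codimTwo_weil_of_quotients (hX5 : X.dim = 5)
    (hq : ∀ (B : AbelianVariety ℂ) (α : X ⟶ B), B.dim = 4 →
      AlgebraicGeometry.Surjective (AbelianVariety.Hom.toSchemeHom α) →
      ¬ B.IsSimple ∨ IsOfCMType B ∨
        ∃ (φ : B ⟶ B) (d : ℕ), 0 < d ∧ φ ≫ φ = -(d • 𝟙 B) ∧ Module.finrank ℚ B.endAlgebra = 2)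
    (c : complexBetti X.X (2 * 2)) (hc : IsRationalClass c) (h22 : IsOfHodgeType X.dim X.X (2 * 2) 2 2 c) :
    c ∈ divisorClassesSpan X.X X.dim 2 ⊔
      Submodule.span ℂ {x : complexBetti X.X (2 * 2) |
        ∃ (B : AbelianVariety ℂ) (α : X ⟶ B) (d : ℕ) (φ : B ⟶ B) (w : complexBetti B.X (2 * 2)),
          B.dim = 4 ∧ AlgebraicGeometry.Surjective (AbelianVariety.Hom.toSchemeHom α) ∧ 0 < d ∧
          φ ≫ φ = -(d • 𝟙 B) ∧ IsRationalClass w ∧ IsOfHodgeType B.dim B.X (2 * 2) 2 2 w ∧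
          w ∈ weilClassesOf B φ 2 d ∧ x = complexBetti.map α.hom.hom.hom (2 * 2) w} :=
  (isCodimTwoDivisorPullbackGenerated_of_dim_eq_five hX5).codimTwo_weil
    (fun B α hB4 hα => isCodimTwoDivisorWeilGenerated_of_not_isSimple_or_cm_or_imaginaryQuadratic hB4
      (hq B α hB4 hα)) c hc h22

/-- **Thm. 0.2 (1)–(2), codimension `3`, `W_{k,α}` FORM — UNCONDITIONAL for a fivefold all of whose surjective
fourfold quotients are non-simple, of CM type, or simple with imaginary-quadratic `End⁰`**:
`B³(X) ⊆ D³(X) ⊗ ℂ ⊔ span_ℂ {κ ∪ α^* w}` = «`D³(X) + D¹(X) · Σ W_{k,α}`».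
[cite: MoonenZarhin1999LowDim, Thm. 0.2 (1)–(2) and §5 (5.12)] [cite: VoisinHodgeI2002, Thm. 6.25 and Rem. 6.27] -/
theorem codimThree_weil_of_quotients (hX5 : X.dim = 5)
    (hq : ∀ (B : AbelianVariety ℂ) (α : X ⟶ B), B.dim = 4 →
      AlgebraicGeometry.Surjective (AbelianVariety.Hom.toSchemeHom α) →
      ¬ B.IsSimple ∨ IsOfCMType B ∨
        ∃ (φ : B ⟶ B) (d : ℕ), 0 < d ∧ φ ≫ φ = -(d • 𝟙 B) ∧ Module.finrank ℚ B.endAlgebra = 2)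
    (c : complexBetti X.X (2 * 3)) (hc : IsRationalClass c) (h33 : IsOfHodgeType X.dim X.X (2 * 3) 3 3 c) :
    c ∈ divisorClassesSpan X.X X.dim 3 ⊔
      Submodule.span ℂ {x : complexBetti X.X (2 * 3) |
        ∃ (κ : complexBetti X.X 2) (B : AbelianVariety ℂ) (α : X ⟶ B) (d : ℕ) (φ : B ⟶ B)
          (w : complexBetti B.X (2 * 2)),
          IsRationalClass κ ∧ IsOfHodgeType X.dim X.X 2 1 1 κ ∧
          B.dim = 4 ∧ AlgebraicGeometry.Surjective (AbelianVariety.Hom.toSchemeHom α) ∧ 0 < d ∧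
          φ ≫ φ = -(d • 𝟙 B) ∧ IsRationalClass w ∧ IsOfHodgeType B.dim B.X (2 * 2) 2 2 w ∧
          w ∈ weilClassesOf B φ 2 d ∧
          x = cupProduct (show 2 + 2 * 2 = 2 * 3 by norm_num) κ (complexBetti.map α.hom.hom.hom (2 * 2) w)} :=
  (isCodimTwoDivisorPullbackGenerated_of_dim_eq_five hX5).codimThree_weil hX5
    (fun B α hB4 hα => isCodimTwoDivisorWeilGenerated_of_not_isSimple_or_cm_or_imaginaryQuadratic hB4
      (hq B α hB4 hα)) c hc h33

/-- **`W_{k,α}` form in codimensions `2` AND `3` for EVERY fivefold, GRANTED THE FOURFOLD FACT** (hypothesis `h01`,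
Thm. 0.1 in codimension `2`). [cite: MoonenZarhin1999LowDim, Thm. 0.1 and Thm. 0.2 (1)–(2)] -/
theorem codimTwo_and_codimThree_weil_of_fourfoldFact (hX5 : X.dim = 5)
    (h01 : MoonenZarhin1999_codimTwoHodgeClasses_abelianFourfold) :
    (∀ c : complexBetti X.X (2 * 2), IsRationalClass c → IsOfHodgeType X.dim X.X (2 * 2) 2 2 c →
      c ∈ divisorClassesSpan X.X X.dim 2 ⊔
        Submodule.span ℂ {x : complexBetti X.X (2 * 2) |
          ∃ (B : AbelianVariety ℂ) (α : X ⟶ B) (d : ℕ) (φ : B ⟶ B) (w : complexBetti B.X (2 * 2)),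
            B.dim = 4 ∧ AlgebraicGeometry.Surjective (AbelianVariety.Hom.toSchemeHom α) ∧ 0 < d ∧
            φ ≫ φ = -(d • 𝟙 B) ∧ IsRationalClass w ∧ IsOfHodgeType B.dim B.X (2 * 2) 2 2 w ∧
            w ∈ weilClassesOf B φ 2 d ∧ x = complexBetti.map α.hom.hom.hom (2 * 2) w}) ∧
    (∀ c : complexBetti X.X (2 * 3), IsRationalClass c → IsOfHodgeType X.dim X.X (2 * 3) 3 3 c →
      c ∈ divisorClassesSpan X.X X.dim 3 ⊔
        Submodule.span ℂ {x : complexBetti X.X (2 * 3) |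
          ∃ (κ : complexBetti X.X 2) (B : AbelianVariety ℂ) (α : X ⟶ B) (d : ℕ) (φ : B ⟶ B)
            (w : complexBetti B.X (2 * 2)),
            IsRationalClass κ ∧ IsOfHodgeType X.dim X.X 2 1 1 κ ∧
            B.dim = 4 ∧ AlgebraicGeometry.Surjective (AbelianVariety.Hom.toSchemeHom α) ∧ 0 < d ∧
            φ ≫ φ = -(d • 𝟙 B) ∧ IsRationalClass w ∧ IsOfHodgeType B.dim B.X (2 * 2) 2 2 w ∧
            w ∈ weilClassesOf B φ 2 d ∧
            x = cupProduct (show 2 + 2 * 2 = 2 * 3 by norm_num) κ (complexBetti.map α.hom.hom.hom (2 * 2) w)}) :=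
  ⟨(isCodimTwoDivisorPullbackGenerated_of_dim_eq_five hX5).codimTwo_weil_of_fourfoldFact h01,
    (isCodimTwoDivisorPullbackGenerated_of_dim_eq_five hX5).codimThree_weil_of_fourfoldFact hX5 h01⟩

/-- **`W_{k,α}` form in codimensions `2` AND `3` for EVERY fivefold, GRANTED ONLY THE ROW-FOUR RESIDUAL** — `B² ⊆ D² +
Σ_K W_K` on the simple non-CM fourfolds whose endomorphism algebra is NOT an imaginary quadratic field and which are
not of minimal quaternion, maximal real-multiplication or quartic CM `{(1,1),(2,0)}` type (Moonen–Zarhin 1995's types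
I(1), I(2), II/III over `ℚ`, IV(2,1), IV with `d = 2`): by
`moonenZarhin1999_codimTwoHodgeClasses_abelianFourfold_iff_residual_noImaginaryQuadratic` this residual IS the fourfold
fact. [cite: MoonenZarhin1999LowDim, Thm. 0.1, Thm. 0.2 (1)–(2)] [cite: MoonenZarhin1995Duke, Thm. 2.4] -/
theorem codimTwo_and_codimThree_weil_of_residual (hX5 : X.dim = 5)
    (hres : ∀ A : AbelianVariety ℂ, A.dim = 4 → A.IsSimple → ¬ IsOfCMType A →
        (¬ ∃ (φ : A ⟶ A) (d : ℕ), 0 < d ∧ φ ≫ φ = -(d • 𝟙 A) ∧ Module.finrank ℚ A.endAlgebra = 2) →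
        (¬ ∃ (K : Type) (_ : Field K) (_ : NumberField K) (_ : IsTotallyReal K) (_ : Algebra K A.endAlgebra)
          (_ : IsScalarTower ℚ K A.endAlgebra) (_ : IsQuaternionAlgebra K A.endAlgebra),
            A.dim = 2 * Module.finrank ℚ K) →
        (¬ ∃ hF : IsField A.endAlgebra, NumberField.IsTotallyReal (EndField A hF) ∧
          Module.finrank ℚ A.endAlgebra = A.dim) →
        (¬ ∃ (φ : A ⟶ A) (μ₁ μ₂ : ℂ), Module.finrank ℚ A.endAlgebra = 4 ∧ starRingEnd ℂ μ₁ ≠ μ₁ ∧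
          starRingEnd ℂ μ₂ ≠ μ₂ ∧ μ₂ ≠ μ₁ ∧ μ₂ ≠ starRingEnd ℂ μ₁ ∧ eigenMultiplicity A φ μ₁ = 1 ∧
          eigenMultiplicity A φ (starRingEnd ℂ μ₁) = 1 ∧ eigenMultiplicity A φ μ₂ = 2) →
        IsCodimTwoDivisorWeilGenerated A) :
    (∀ c : complexBetti X.X (2 * 2), IsRationalClass c → IsOfHodgeType X.dim X.X (2 * 2) 2 2 c →
      c ∈ divisorClassesSpan X.X X.dim 2 ⊔
        Submodule.span ℂ {x : complexBetti X.X (2 * 2) |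
          ∃ (B : AbelianVariety ℂ) (α : X ⟶ B) (d : ℕ) (φ : B ⟶ B) (w : complexBetti B.X (2 * 2)),
            B.dim = 4 ∧ AlgebraicGeometry.Surjective (AbelianVariety.Hom.toSchemeHom α) ∧ 0 < d ∧
            φ ≫ φ = -(d • 𝟙 B) ∧ IsRationalClass w ∧ IsOfHodgeType B.dim B.X (2 * 2) 2 2 w ∧
            w ∈ weilClassesOf B φ 2 d ∧ x = complexBetti.map α.hom.hom.hom (2 * 2) w}) ∧
    (∀ c : complexBetti X.X (2 * 3), IsRationalClass c → IsOfHodgeType X.dim X.X (2 * 3) 3 3 c →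
      c ∈ divisorClassesSpan X.X X.dim 3 ⊔
        Submodule.span ℂ {x : complexBetti X.X (2 * 3) |
          ∃ (κ : complexBetti X.X 2) (B : AbelianVariety ℂ) (α : X ⟶ B) (d : ℕ) (φ : B ⟶ B)
            (w : complexBetti B.X (2 * 2)),
            IsRationalClass κ ∧ IsOfHodgeType X.dim X.X 2 1 1 κ ∧
            B.dim = 4 ∧ AlgebraicGeometry.Surjective (AbelianVariety.Hom.toSchemeHom α) ∧ 0 < d ∧
            φ ≫ φ = -(d • 𝟙 B) ∧ IsRationalClass w ∧ IsOfHodgeType B.dim B.X (2 * 2) 2 2 w ∧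
            w ∈ weilClassesOf B φ 2 d ∧
            x = cupProduct (show 2 + 2 * 2 = 2 * 3 by norm_num) κ (complexBetti.map α.hom.hom.hom (2 * 2) w)}) :=
  codimTwo_and_codimThree_weil_of_fourfoldFact hX5
    (moonenZarhin1999_codimTwoHodgeClasses_abelianFourfold_iff_residual_noImaginaryQuadratic.2 hres)

end Summit.HodgeConjecture.Ring2.FivefoldHodgeRingAllCodimensions

end
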